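import Mathlib
import HarnessLib

/-!
# Teräväinen 2024, §5.3: the change of variables on `ℤ_N^k` (Proposition 5.3, first step)

Support file (everything PROVED; no definitions, no named facts) towards the named fact
`Literature.NumberTheory.Sieve.teravainen2024_cor_2_1` (J. Teräväinen, *On the Liouville function
at polynomial arguments*, Amer. J. Math. 146 (2024) = arXiv:2010.07924, Corollary 2.1 ⊂
Theorem 2.6 for `g_j = λ`, proved in §5). The proof of Proposition 5.3 (the 99% inverse theorem,
§5.3) begins (p. 12) with

> "We then make the change of variables `n = ∑_{j ≤ k} h_j x_j`, `d = -(x_1 + ⋯ + x_k)`. Since `N`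
> is a large prime, we easily see that every pair `(n, d)` corresponds to essentially the same
> number `(ε + o_{N→∞}(1)) N^{k-2}` choices of `(x_1, …, x_k)`. … where `L_0(𝐱) = -(x_1+⋯+x_k)`,
> `L_j(𝐱) = ∑_{i ≤ k} (h_i - h_j) x_i`. Note that, importantly, `L_j` is independent of the
> `j`th coordinate."

This file proves the exact algebraic content: for a prime `N` and shifts `h_j` two of which are
distinct modulo `N`, the map `𝐱 ↦ (∑ h_j x_j, -∑ x_j)` from `ℤ_N^k` to `ℤ_N²` is a surjective
group homomorphism, so EVERY pair `(n, d)` has exactly `N^{k-2}` preimages and sums over `ℤ_N^k`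
of functions of `(n, d)` are `N^{k-2}` times the corresponding sums over `ℤ_N²`; and
`n + d h_j = L_j(𝐱) = ∑_i (h_i - h_j) x_i` does not involve `x_j`.

* `Teravainen2024.sum_comp_addMonoidHom_eq` — for a surjective homomorphism `φ : G →+ H` of
  finite abelian groups, `∑_{g} F(φ g) = |ker φ| · ∑_{h} F(h)`;
* `Teravainen2024.changeOfVariables_surjective`, `sum_changeOfVariables_eq` — the map above, its
  surjectivity for prime `N`, and the summation identity (fibres of size `N^{k-2}`);
* `Teravainen2024.linearForm_indep`, `linearForm_update` — `∑ h_i x_i + (-∑ x_i) h_j = ∑_i (h_i - h_j) x_i`,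
  independent of `x_j`.

## References
* J. Teräväinen, Amer. J. Math. 146 (2024), §5.3, proof of Proposition 5.3 (the change of
  variables, p. 12), arXiv:2010.07924. [Teravainen2024]
-/

noncomputable section

open Finset

namespace Literature.NumberTheory.Sieve

namespace Teravainen2024

/-! ### Sums through a surjective homomorphism -/

section hom

variable {G H : Type*} [AddCommGroup G] [Fintype G] [AddCommGroup H] [Fintype H] [DecidableEq H]

omit [Fintype H] in
/-- All fibres of a surjective homomorphism of finite abelian groups have the cardinality of the
kernel. [folklore] -/
theorem card_fiber_eq_card_ker (φ : G →+ H) (hφ : Function.Surjective φ) (y : H) :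
    #(Finset.univ.filter fun g : G => φ g = y) = #(Finset.univ.filter fun g : G => φ g = 0) := by
  obtain ⟨g₀, hg₀⟩ := hφ y
  refine Finset.card_bij (fun g _ => g - g₀) ?_ ?_ ?_
  · intro g hg
    rw [Finset.mem_filter] at hg ⊢
    exact ⟨Finset.mem_univ _, by rw [map_sub, hg.2, hg₀, sub_self]⟩
  · intro g₁ _ g₂ _ h
    exact sub_left_injective h
  · intro g hg
    rw [Finset.mem_filter] at hg
    refine ⟨g + g₀, ?_, by simp⟩
    rw [Finset.mem_filter]
    exact ⟨Finset.mem_univ _, by rw [map_add, hg.2, hg₀, zero_add]⟩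

/-- **Summing through a surjective homomorphism.** For `φ : G →+ H` surjective between finite
abelian groups and any `F : H → M` (`M` a commutative monoid written additively),
`∑_{g ∈ G} F(φ g) = |ker φ| • ∑_{h ∈ H} F(h)`. [folklore] -/
theorem sum_comp_addMonoidHom_eq {M : Type*} [AddCommMonoid M] (φ : G →+ H)
    (hφ : Function.Surjective φ) (F : H → M) :
    ∑ g : G, F (φ g) = #(Finset.univ.filter fun g : G => φ g = 0) • ∑ y : H, F y := by
  rw [← Finset.sum_fiberwise_of_maps_to (s := (Finset.univ : Finset G)) (t := (Finset.univ : Finset H))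
    (g := fun g => φ g) (fun g _ => Finset.mem_univ _) (fun g => F (φ g)), Finset.smul_sum]
  refine Finset.sum_congr rfl fun y _ => ?_
  have h1 : ∑ g ∈ Finset.univ.filter (fun g : G => φ g = y), F (φ g) =
      ∑ _g ∈ Finset.univ.filter (fun g : G => φ g = y), F y := by
    refine Finset.sum_congr rfl fun g hg => ?_
    rw [(Finset.mem_filter.mp hg).2]
  rw [h1, Finset.sum_const, card_fiber_eq_card_ker φ hφ y]

/-- The kernel cardinality from surjectivity: `|G| = |ker φ| · |H|`. [folklore] -/
theorem card_eq_card_ker_mul_card (φ : G →+ H) (hφ : Function.Surjective φ) :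
    Fintype.card G = #(Finset.univ.filter fun g : G => φ g = 0) * Fintype.card H := by
  have h := sum_comp_addMonoidHom_eq φ hφ (fun _ => (1 : ℕ))
  simp only [Finset.sum_const, smul_eq_mul, mul_one, Finset.card_univ] at h
  exact h

end hom

/-! ### The change of variables `(x_j) ↦ (∑ h_j x_j, -∑ x_j)` on `ℤ_N^k` -/

section cyclic

variable {N k : ℕ}

/-- **The linear forms.** With `n = ∑_i h_i x_i` and `d = -∑_i x_i`:
`n + d h_j = ∑_i (h_i - h_j) x_i`, which does not involve `x_j`.
[cite: Teravainen2024, §5.3, p. 12 ("L_j is independent of the jth coordinate")] -/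
theorem linearForm_indep {R : Type*} [CommRing R] (h x : Fin k → R) (j : Fin k) :
    (∑ i, h i * x i) + (-∑ i, x i) * h j = ∑ i, (h i - h j) * x i := by
  rw [neg_mul, Finset.sum_mul, ← sub_eq_add_neg, ← Finset.sum_sub_distrib]
  refine Finset.sum_congr rfl fun i _ => by ring

/-- The `j`-th summand of `L_j` vanishes: `L_j(𝐱)` is unchanged when `x_j` changes. [folklore] -/
theorem linearForm_update {R : Type*} [CommRing R] [DecidableEq (Fin k)] (h x : Fin k → R)
    (j : Fin k) (v : R) :
    ∑ i, (h i - h j) * Function.update x j v i = ∑ i, (h i - h j) * x i := by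
  refine Finset.sum_congr rfl fun i _ => ?_
  by_cases hij : i = j
  · subst hij; simp
  · rw [Function.update_of_ne hij]

variable [Fact N.Prime]

/-- **Surjectivity.** If `h_i ≠ h_j` in `ℤ_N` (`N` prime) for some `i ≠ j`, then every pair
`(n, d) ∈ ℤ_N²` is of the form `(∑ h_l x_l, -∑ x_l)`, with a solution supported on `{i, j}`.
[cite: Teravainen2024, §5.3, p. 12] -/
theorem changeOfVariables_surjective [DecidableEq (Fin k)] (h : Fin k → ZMod N) {i j : Fin k}
    (hij : i ≠ j) (hh : h i ≠ h j) (n d : ZMod N) :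
    ∃ x : Fin k → ZMod N, (∑ l, h l * x l) = n ∧ (-∑ l, x l) = d := by
  -- `x_i = u`, `x_j = -d - u`, zero elsewhere, with `(h_i - h_j) u = n + h_j d`
  set u : ZMod N := (n + h j * d) / (h i - h j) with hu
  have hne : h i - h j ≠ 0 := sub_ne_zero.mpr hh
  set x : Fin k → ZMod N := Function.update (Function.update (fun _ => 0) j (-d - u)) i u with hx
  have hxi : x i = u := by simp [hx]
  have hxj : x j = -d - u := by simp [hx, Function.update_of_ne hij.symm]
  have hxl : ∀ l, l ≠ i → l ≠ j → x l = 0 := by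
    intro l hli hlj; simp [hx, Function.update_of_ne hli, Function.update_of_ne hlj]
  -- sums supported on `{i, j}`
  have hsum : ∀ c : Fin k → ZMod N, ∑ l, c l * x l = c i * u + c j * (-d - u) := by
    intro c
    rw [← Finset.sum_subset (Finset.subset_univ ({i, j} : Finset (Fin k)))]
    · rw [Finset.sum_pair hij, hxi, hxj]
    · intro l _ hl
      rw [Finset.mem_insert, Finset.mem_singleton, not_or] at hl
      rw [hxl l hl.1 hl.2, mul_zero]
  refine ⟨x, ?_, ?_⟩
  · rw [hsum h]
    have : h i * u + h j * (-d - u) = (h i - h j) * u - h j * d := by ring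
    rw [this, hu, mul_div_cancel₀ _ hne]; ring
  · have := hsum (fun _ => 1)
    simp only [one_mul] at this
    rw [this]; ring

/-- **Uniform fibres and the summation identity.** Under the same hypothesis, for every
`F : ℤ_N → ℤ_N → M`:
`∑_{𝐱 ∈ ℤ_N^k} F(∑ h_l x_l, -∑ x_l) = N^{k-2} • ∑_{n} ∑_{d} F(n, d)` — every pair `(n, d)` has
exactly `N^{k-2}` preimages. [cite: Teravainen2024, §5.3, p. 12 ("every pair (n,d) corresponds to
… the same number … N^{k-2} choices of (x_1, …, x_k)")] -/
theorem sum_changeOfVariables_eq [DecidableEq (Fin k)] {M : Type*} [AddCommMonoid M]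
    (h : Fin k → ZMod N) {i j : Fin k} (hij : i ≠ j) (hh : h i ≠ h j) (F : ZMod N → ZMod N → M) :
    ∑ x : Fin k → ZMod N, F (∑ l, h l * x l) (-∑ l, x l) = N ^ (k - 2) • ∑ n : ZMod N, ∑ d : ZMod N, F n d := by
  classical
  -- the homomorphism
  set φ : (Fin k → ZMod N) →+ ZMod N × ZMod N :=
    { toFun := fun x => (∑ l, h l * x l, -∑ l, x l)
      map_zero' := by simp
      map_add' := fun x y => by
        simp only [Pi.add_apply, mul_add, Finset.sum_add_distrib, neg_add, Prod.mk_add_mk] } with hφ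
  have hφapp : ∀ x, φ x = (∑ l, h l * x l, -∑ l, x l) := fun x => rfl
  have hsurj : Function.Surjective φ := by
    rintro ⟨n, d⟩
    obtain ⟨x, h1, h2⟩ := changeOfVariables_surjective h hij hh n d
    exact ⟨x, by rw [hφapp, h1, h2]⟩
  have hmain := sum_comp_addMonoidHom_eq φ hsurj (fun p => F p.1 p.2)
  simp only [hφapp] at hmain
  rw [hmain, ← Finset.sum_product', Finset.univ_product_univ]
  congr 1
  -- the kernel has `N^{k-2}` elements: `N^k = |ker| · N²`
  have hcard := card_eq_card_ker_mul_card φ hsurj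
  rw [Fintype.card_pi, Finset.prod_const, Finset.card_univ, Fintype.card_fin, Fintype.card_prod,
    ZMod.card] at hcard
  have hk2 : 2 ≤ k := by
    rcases Nat.lt_or_ge k 2 with hlt | hge
    · exfalso
      have : Fintype.card (Fin k) < 2 := by simpa using hlt
      exact absurd (Fintype.one_lt_card_iff_nontrivial.mpr ⟨⟨i, j, hij⟩⟩) (by omega)
    · exact hge
  have hN : 0 < N := (Fact.out : N.Prime).pos
  have : N ^ k = N ^ (k - 2) * (N * N) := by
    rw [← pow_two, ← pow_add, Nat.sub_add_cancel hk2]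
  rw [this] at hcard
  exact (Nat.eq_of_mul_eq_mul_right (by positivity) hcard).symm

end cyclic

end Teravainen2024

end Literature.NumberTheory.Sieve
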